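import Summits.QuantumFields.YangMills.Theorems.BalabanUVNodesK1AxV114Defs
import Summits.QuantumFields.YangMills.Theorems.BalabanUVNodesK1AxV11Roads
import Summits.QuantumFields.YangMills.Theorems.BalabanUVNodesK1AxV11LettersDefs
import Summits.QuantumFields.YangMills.Theorems.BalabanUVNodesK1AxStubCont13DoorOfKernelLetters
import Summits.QuantumFields.YangMills.Theses.BalabanUVNodes

/-!
# K1ᴬ v11.4 — THE BY-NAME CONCLUDERS OVER THE RE-REGISTERED (RUN-KEYED) LINE-2′ TEXTS (`K1AxV114StubTexts.Stub1TextVW` ∕ `Stub2TextVW` of ✓`…K1AxV114Defs` + the unchanged `Stub3TextVW` ∕ `Stub3LTextVW` ∕ per-radius letters):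
# a lane that proves the v11.4 texts BY NAME feeds the route decl `StabilityBRunRowsAtRecordR13SepCoPHVAx` through ONE `exact` below — the v11.4 twin (after the v11.3 sibling ✓p836360, now history) of ✓`…K1AxV11StubTexts` §1 (g24) and
# ✓`…K1AxV11LettersByName` (g25), here keyed on the NAMED texts (h₁ h₂ : `Stub1TextVW` ∕ `Stub2TextVW`) so no statement coincides with a v11.2 homonym; ★★★ director-ym №682 (2)(e′)∕№685, ✦ plan g104 v11.4 registration 33e8cfceee350f1c (0∕6 (v11.4; guard (R-a″) run-keyed))

R134 seat `pub-ymgap-dag-n24-c` g27 (the -a hand on LINE 2′), `--kind proof --supports stmt-QuantumFields-27239 --as helper` (count-neutral; theorems only — the two v11.3 text DEFS live in ✓`…K1AxV114Defs`,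
this file imports the route file DIRECTLY because the concluders' TYPE is the route decl literally, and otherwise only route-independent∕already-landed modules: E1, ✓`K1AxV11Roads`, ✓`K1AxV11LettersDefs`, ✓`K1AxStubCont13DoorOfKernelLetters`).  The kit's own R1W composition `k1R9_of_stubsVW` is re-proved here over the v11.4 rung-1ⱽᵂ text in four
lines (rung 2ⱽᵂ, rung 2ⱽᵂ‴ and the W-END road `K1AxV11Defs.endStatementBPrinted_window_of_recordSV_of_nodesW_of_runLetters` are UNCHANGED at v11.4 — they never read the pin).

HONEST COST (★★★ №663 (1) ∕ №682, verbatim): «N12 ([IV] basic step) is pinned at every windowed run WHOSE MEMORY FITS; at shorter runs the `rBasicStep` leaf of `Nodes` is unpinned because print applies no 𝐑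
there» — a GAP-STATED corner, named and sourced.
HONEST FRAMING.  Naming ∕ composition only; NO stub proved or claimed; the concluders are CONDITIONAL on the texts of the line (audit `proof.conditional`); K1ᴬ OPEN (0∕6, never summed across lines);
counts UNMOVED (discharged 8∕27, A 8∕28 · K 1∕4).  One finite 𝕋⁴ programme at fixed `ε` — NOT continuum ∕ ℝ⁴ ∕ OS ∕ mass gap ∕ Clay.  No `def`, `sorry`, `instance`, `notation`; standard axioms.
-/

set_option autoImplicit false

noncomputable section

namespace Summit.QuantumFields.YangMills.Theorems.K1AxV114StubTexts

open Literature.MathematicalPhysics.QuantumFieldTheory.Balaban1983to89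
open Literature.MathematicalPhysics.QuantumFieldTheory.Balaban1983to89.T4Continuum (T4Family)
open Summit.QuantumFields.YangMills.Theorems.K1AxV11Defs (Inhabited13 RunRowsAtSomeRecord13PWSVW RunRowsContAtSomeRecord13PWSVW endStatementBPrinted_window_of_recordSV_of_nodesW_of_runLetters)
open Summit.QuantumFields.YangMills.Theorems.K1AxV114Defs (NodesAtSomeRecord13PWSVW)
open Summit.QuantumFields.YangMills.Theorems.K1AxV11StubTexts (Stub3LTextVW stubCont13VW_text_of_stub3LTextVW)
open Summit.QuantumFields.YangMills.Theorems.K0RecordFormatNames (PolLimitLocUnifOnBox₁₃Ax PlimDecayOnBox₁₃Ax PvolHistContOnBox₁₃Ax)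
open Summit.QuantumFields.YangMills.Theorems.K1AxStubCont13DoorOfKernelLetters (stubLetters13VW_of_letters₁₃AxAtRadius)

/-- ★ **THE v11.4 R1W COMPOSITION READ AT THE ROUTE DECL** (the kit's `k1R9_of_stubsVW` over the RUN-KEYED MEMORY-GUARDED rung 1ⱽᵂ): rung 0 at `F` ⟹ rung 1ⱽᵂ (v11.4) ⟹ rung 2ⱽᵂ ⟹ rung 2ⱽᵂ‴ ⟹ the W-END road
⟹ K1ᴬ's body at `F`.  CONDITIONAL on the three implications; closes nothing. [cite: Balaban1989LargeFieldII, Thm 1 p.355 + (0.1) pp.355–356; Balaban1987RG1, Thm 3 p.264 (bookkeeping)] -/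
theorem k1R9_of_stubsVW
    (h₁ : ∀ F : T4Family, Inhabited13 F → K1AxV114Defs.NodesAtSomeRecord13PWSVW F)
    (h₂ : ∀ F : T4Family, K1AxV114Defs.NodesAtSomeRecord13PWSVW F → RunRowsAtSomeRecord13PWSVW F)
    (h₃ : ∀ F : T4Family, RunRowsAtSomeRecord13PWSVW F → RunRowsContAtSomeRecord13PWSVW F) :
    Summit.QuantumFields.YangMills.Theses.BalabanUVNodes.StabilityBRunRowsAtRecordR13SepCoPHVAx := by
  unfold Summit.QuantumFields.YangMills.Theses.BalabanUVNodes.StabilityBRunRowsAtRecordR13SepCoPHVAx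
  intro F hinh
  obtain ⟨θ, h, v, w, hU, hθ, hR, hnodes, b, r, γ₀, B, M, hγ₀, hrem, hB, hmatch, hps, hsc⟩ := h₃ F (h₂ F (h₁ F hinh))
  obtain ⟨hb, hwin⟩ := endStatementBPrinted_window_of_recordSV_of_nodesW_of_runLetters hR hnodes hγ₀ hrem hB hmatch hps
  exact ⟨θ, h, v, hU, hθ, hb, hwin, b, r, γ₀, M, hγ₀, hrem, hps, hsc⟩

/-- ★ **K1ᴬ BY ITS ROUTE NAME FROM LINE 2′'s THREE v11.4 TEXTS** (`Stub1TextVW` ∕ `Stub2TextVW` of ✓`…K1AxV114Defs`; stub 3ⱽᵂ's text unfolded — its name ✓`K1AxV11StubTexts.Stub3TextVW` is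
unchanged at v11.4 and lives in the Theses-cone file, so it is spelled here).  CONDITIONAL; closes nothing.
[cite: Balaban1989LargeFieldII, Thm 1 p.355 + (0.1) pp.355–356; Balaban1987RG1, Thm 3 p.264 (bookkeeping)] -/
theorem stabilityBRunRowsAtRecordR13SepCoPHVAx_of_stubTextsVW (h₁ : K1AxV114StubTexts.Stub1TextVW) (h₂ : K1AxV114StubTexts.Stub2TextVW)
    (h₃ : ∀ F : T4Family, RunRowsAtSomeRecord13PWSVW F → RunRowsContAtSomeRecord13PWSVW F) :
    Summit.QuantumFields.YangMills.Theses.BalabanUVNodes.StabilityBRunRowsAtRecordR13SepCoPHVAx :=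
  k1R9_of_stubsVW h₁ h₂ h₃

/-- ★ **K1ᴬ BY ITS ROUTE NAME FROM THE v11.4 TEXTS `Stub1TextVW`, `Stub2TextVW` AND THE (unchanged) LETTER TEXT `Stub3LTextVW`** (bridge `stubCont13VW_text_of_stub3LTextVW`).  CONDITIONAL; closes nothing.
[cite: Balaban1989LargeFieldII, Thm 1 p.355 + (0.1) pp.355–356; Balaban1987RG1, Thm 1 p.259, Thm 3 p.264 (bookkeeping)] -/
theorem stabilityBRunRowsAtRecordR13SepCoPHVAx_of_textsLVW (h₁ : K1AxV114StubTexts.Stub1TextVW) (h₂ : K1AxV114StubTexts.Stub2TextVW) (h₃ : Stub3LTextVW) :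
    Summit.QuantumFields.YangMills.Theses.BalabanUVNodes.StabilityBRunRowsAtRecordR13SepCoPHVAx :=
  k1R9_of_stubsVW h₁ h₂ (stubCont13VW_text_of_stub3LTextVW h₃)

/-- ★★ **K1ᴬ BY ITS ROUTE NAME FROM THE v11.4 TEXTS 1ⱽᵂ, 2ⱽᵂ AND THE ∀θ PER-RADIUS NAMED β-KERNEL LETTERS** in place of `stub_letters13VW` (door ✓`stubLetters13VW_of_letters₁₃AxAtRadius`).
CONDITIONAL on the two texts and the letters at every rung-0 tuple; closes nothing. [cite: Balaban1989LargeFieldII, Thm 1 p.355 + (0.1) pp.355–356; Balaban1987RG1, Thm 1 p.259, Thm 3 p.264,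
(1.20)–(1.22) p.264, (5.10) p.293 (bookkeeping)] -/
theorem stabilityBRunRowsAtRecordR13SepCoPHVAx_of_texts12VW_of_letters₁₃AxAtRadius (h₁ : K1AxV114StubTexts.Stub1TextVW) (h₂ : K1AxV114StubTexts.Stub2TextVW)
    (H : ∀ (F : T4Family) (θ : Node00.Stage13HParams F 2), θ.Provisos₁₃SepCoPHAx F 2 → (θ.ZhUnity F 2 ∧ θ.SlotsNondegenerate₁₃Ax F 2) → θ.Admissible F 2 →
      ∃ γc : ℝ, 0 < γc ∧ γc ≤ θ.γ ∧ PolLimitLocUnifOnBox₁₃Ax F 2 θ.toStage13Params γc ∧ (∃ C δ₁ : ℝ, PlimDecayOnBox₁₃Ax F 2 θ.toStage13Params γc C δ₁) ∧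
        PvolHistContOnBox₁₃Ax F 2 θ.toStage13Params γc) :
    Summit.QuantumFields.YangMills.Theses.BalabanUVNodes.StabilityBRunRowsAtRecordR13SepCoPHVAx :=
  stabilityBRunRowsAtRecordR13SepCoPHVAx_of_textsLVW h₁ h₂ (stubLetters13VW_of_letters₁₃AxAtRadius H)

end Summit.QuantumFields.YangMills.Theorems.K1AxV114StubTexts

end
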